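import Summits.BirchSwinnertonDyer.BirchSwinnertonDyer.Theorems.AlignedTransportAtTwoMainConjectureOfRankZeroBSDAtTwoFineRoadArchRigidity
import Summits.BirchSwinnertonDyer.BirchSwinnertonDyer.Theorems.AlignedTransportAtTwoMainConjectureOfRankZeroBSDAtTwoFineRoadArchReceptacle
import Literature.NumberTheory.EllipticCurves.IwasawaSelmerRelaxedAtInfinity
import HarnessLib

/-!
# AR-OF-PRINT (pen RC-427 / RC-429) WITHOUT a new Literature fact — Aʳ in its LENGTH form from the EXISTING PRINT fact
# `Greenberg1999.lemma46_relaxed_mod_selmer_infinite_rat_two` (p608868, `Literature/…/GreenbergArchimedeanSelmerFactorAtTwo.lean`,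
# cell bsd-f1-sign2, 2026-08-28: Greenberg LNM 1716 §4 Lemma 4.6 + Remark pp. 105–107 at (2, ℚ), WEAKER than print: «Sel(E/ℚ_∞)₂ has
# INFINITE index in Sel^{rel ∞}» under good ordinary at 2, 0 < Δ, cyclotomic κ, Λ-cotorsion) and the bsd-f1-sign2 KERNEL apparatus
# `AlignedTransportAtTwoFineRoad.{ArchKernel, ArchReceptacle, ArchRigidity}` — transported VERBATIM to the bsd-2adic carrier
# `WeierstrassCurve.SelmerDualDataRelaxedInf` (w2 p703162), the two relaxed-at-∞ Selmer groups being the same subgroup by `rfl`.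

bsd-2adic-audit-2 GEN 64 (literature-prover; Summits/Theorems is prover-only for this role — dry-run `perm.theorems-prover-only` —
so this file is EVIDENCE on stmt-BirchSwinnertonDyer-24097 / 19573 for the w2 lineage or any prover to land `--supports 24097`).
LANDED VERBATIM (body unchanged; this one paragraph added) by the LEAD `cruxlead-stmt-BirchSwinnertonDyer-19573-g8` under pen RC-438
GO #2 (one-writer re-assignment, D-0071), `--supports stmt-BirchSwinnertonDyer-24097 --as helper`; consumers: the v19 skeleton's B7′ road
(`…OrdKatoHalfAtTwoIsoRelaxedOptimalExistsMember*`) and the §4 relaxed-genuine alternative door, keyed on (h46, hD) instead of Aʳ.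
HONEST FRAMING: nothing new is asserted; every theorem below is conditional on the named PRINT fact `h46` (and on the cotorsion
hypothesis `D.IsTorsion`, which the consumer door feeds from Kato 17.4 (1) at 2 = `h17`); the crux 19573, its `0 < Δ` conjunct and
the PAIR child 24097 stay OPEN; BSD is not proved by any of this.

* `relaxedSelmerInftyAtTwo_eq_selmerInftyRelaxedInf` — the bsd-f1-sign2 carrier IS the bsd-2adic carrier (`rfl`).
* `module_finite_relaxedDual` — every `Dr : W.SelmerDualDataRelaxedInf κ γ` has `Dr.X` finitely generated over Λ (f1-sign2
  `ArchReceptacle.module_finite_of_pinned`, dual Nakayama) — UNCONDITIONAL.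
* `one_le_lengthAt_ker_of_lemma46` — GRANTED h46: `1 ≤ ℓ₍₂₎(ker q)` for every `(D, Dr, q)` of Aʳ's binder list with `D.IsTorsion`
  (= Aʳ's content in the currency every consumer uses: `…RelaxedGenuineDefs.relaxedColemanData_of_relaxedZeta_of_arch` extracts from
  `hA` exactly `ℓ₍₂₎(D.X) + 1 ≤ ℓ₍₂₎(Dr.X)` via `lengthAt_add_one_le_of_archExtension`).
* `lengthAt_selmer_add_one_le_relaxed_of_lemma46` — GRANTED h46: `ℓ₍₂₎(D.X) + 1 ≤ ℓ₍₂₎(Dr.X)` (f1-sign2 `ArchRigidity`).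
* `ker_eq_bot_of_Δ_neg` — `Δ < 0`: `q` injective, UNCONDITIONAL (f1-sign2 `ArchKernel.archExtension_injective_of_Δ_neg`).
The INJECTION form of Aʳ (`Λ/(2) ↪ ker q`) would need one more PID step («f.g. 2-torsion Λ-module of positive (2)-length contains
Λ/(2)»); no consumer needs it.

References: [GreenbergLNM1716] §4 Lemma 4.6 (p. 105), Remark (pp. 106–107), proof (pp. 107–108, exact sequence on p. 108);
tree p608868 (the fact), bsd-f1-sign2 att-p4 files (2026-08-28), w2 p703162 / p705378 (carriers, Aʳ text).
-/

set_option autoImplicit false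
-- the Theorems namespace of this sub repeats the summit name by design (D-0017 nested layout)
set_option linter.dupNamespace false

noncomputable section

open scoped Classical

namespace Summit.BirchSwinnertonDyer.BirchSwinnertonDyer.Theorems.SteinbergFibreAtTwo.ArchOfLemma46

open WeierstrassCurve Field Literature.NumberTheory.EllipticCurves Literature.NumberTheory.EllipticCurves.IwasawaAlgebra
  Literature.NumberTheory.EllipticCurves.Module Literature.NumberTheory.EllipticCurves.Greenberg1999
  Summit.BirchSwinnertonDyer.BirchSwinnertonDyer.Theorems.AlignedTransportAtTwoFineRoad

variable (W : WeierstrassCurve ℚ) (κ : ZpExtension ℚ 2) {γ : Field.absoluteGaloisGroup ℚ}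

/-- The bsd-f1-sign2 relaxed-at-`∞` Selmer group over `ℚ_∞` IS the bsd-2adic one (same `⨅` over finite places and conjugates).
[cite: GreenbergLNM1716, §4 Remark after Lemma 4.6 (PDF p. 106)] -/
theorem relaxedSelmerInftyAtTwo_eq_selmerInftyRelaxedInf :
    relaxedSelmerInftyAtTwo W κ = W.selmerInftyRelaxedInf κ := rfl

/-- **Every relaxed Selmer dual datum is finitely generated over `Λ`** (dual Nakayama, f1-sign2 `ArchReceptacle.module_finite_of_pinned`
applied to the fields of `Dr`). Unconditional. [cite: GreenbergLNM1716, §1 p. 60 (after Conj. 1.3)] -/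
theorem module_finite_relaxedDual [W.IsElliptic] (hγ : κ.IsTopGenerator γ) (Dr : W.SelmerDualDataRelaxedInf κ γ) :
    Module.Finite (IwasawaAlgebra 2) Dr.X :=
  ArchReceptacle.module_finite_of_pinned W κ hγ Dr.toDual Dr.bijective Dr.toDual_T_smul Dr.toDual_C_smul

/-- **Aʳ, LENGTH FORM, GRANTED the PRINT fact h46 (Greenberg L.4.6 + Remark at 2, p608868):** for `W/ℚ` globally minimal, elliptic,
good ordinary at `2`, `0 < Δ_W`, `κ` cyclotomic with topological generator `γ`, every TORSION Selmer dual datum `D`, every relaxed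
datum `Dr` and every `Λ`-linear `q : Dr.X → D.X` restricting characters: `1 ≤ ℓ₍₂₎(ker q)`. No new fact; f1-sign2 kernel by name.
[cite: GreenbergLNM1716, §4 Lemma 4.6 (p. 105) and Remark (pp. 106–107)] -/
theorem one_le_lengthAt_ker_of_lemma46 (h46 : lemma46_relaxed_mod_selmer_infinite_rat_two)
    [W.IsElliptic] [W.IsGloballyMinimal] (hord : IsOrdinaryAt W 2) (hΔ : 0 < W.Δ)
    (hκ : κ.IsCyclotomic) (hγ : κ.IsTopGenerator γ)
    (D : W.SelmerDualData κ γ) (Dr : W.SelmerDualDataRelaxedInf κ γ) (hD : D.IsTorsion)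
    (q : Dr.X →ₗ[IwasawaAlgebra 2] D.X)
    (hq : ∀ (x : Dr.X) (s : W.selmerInfty κ),
      D.toDual (q x) s = Dr.toDual x (AddSubgroup.inclusion (W.selmerInfty_le_selmerInftyRelaxedInf κ) s)) :
    1 ≤ lengthAt (IwasawaAlgebra 2) (LinearMap.ker q) ⟨augIdealP 2, isPrime_augIdealP_holds 2⟩ :=
  ArchReceptacle.one_le_lengthAt_ker_archExtension' W κ Dr.toDual h46 hord hΔ hκ hγ D hD Dr.bijective Dr.toDual_T_smul
    Dr.toDual_C_smul q hq

/-- **GRANTED h46: `ℓ₍₂₎(X) + 1 ≤ ℓ₍₂₎(X^{rel ∞})`** — exactly the inequality the relaxed-genuine door extracts from Aʳ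
(`…RelaxedGenuineDefs.relaxedColemanData_of_relaxedZeta_of_arch`, via `lengthAt_add_one_le_of_archExtension`). f1-sign2
`ArchRigidity.lengthAt_selmer_add_one_le_lengthAt_relaxed` with `Module.Finite` discharged by `module_finite_relaxedDual`.
[cite: GreenbergLNM1716, §4 Lemma 4.6 (p. 105) and Remark (pp. 106–107)] -/
theorem lengthAt_selmer_add_one_le_relaxed_of_lemma46 (h46 : lemma46_relaxed_mod_selmer_infinite_rat_two)
    [W.IsElliptic] [W.IsGloballyMinimal] (hord : IsOrdinaryAt W 2) (hΔ : 0 < W.Δ)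
    (hκ : κ.IsCyclotomic) (hγ : κ.IsTopGenerator γ)
    (D : W.SelmerDualData κ γ) (Dr : W.SelmerDualDataRelaxedInf κ γ) (hD : D.IsTorsion)
    (q : Dr.X →ₗ[IwasawaAlgebra 2] D.X)
    (hq : ∀ (x : Dr.X) (s : W.selmerInfty κ),
      D.toDual (q x) s = Dr.toDual x (AddSubgroup.inclusion (W.selmerInfty_le_selmerInftyRelaxedInf κ) s)) :
    lengthAt (IwasawaAlgebra 2) D.X ⟨augIdealP 2, isPrime_augIdealP_holds 2⟩ + 1 ≤
      lengthAt (IwasawaAlgebra 2) Dr.X ⟨augIdealP 2, isPrime_augIdealP_holds 2⟩ := by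
  haveI := module_finite_relaxedDual W κ hγ Dr
  exact ArchRigidity.lengthAt_selmer_add_one_le_lengthAt_relaxed W Dr.toDual h46 hord hΔ hκ hγ D hD Dr.bijective q hq

/-- **`Δ_W < 0`: the restriction `q : X^{rel ∞} → X` is injective** (no archimedean factor), UNCONDITIONAL — f1-sign2
`ArchKernel.archExtension_injective_of_Δ_neg`. [cite: GreenbergLNM1716, §4 (PDF p. 106: «usually this group is zero»)] -/
theorem ker_eq_bot_of_Δ_neg [W.IsElliptic] (hΔ : W.Δ < 0) (D : W.SelmerDualData κ γ) (Dr : W.SelmerDualDataRelaxedInf κ γ)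
    (q : Dr.X →ₗ[IwasawaAlgebra 2] D.X)
    (hq : ∀ (x : Dr.X) (s : W.selmerInfty κ),
      D.toDual (q x) s = Dr.toDual x (AddSubgroup.inclusion (W.selmerInfty_le_selmerInftyRelaxedInf κ) s)) :
    LinearMap.ker q = ⊥ :=
  LinearMap.ker_eq_bot.mpr (ArchKernel.archExtension_injective_of_Δ_neg W hΔ D Dr.toDual Dr.bijective q.toAddMonoidHom hq)

end Summit.BirchSwinnertonDyer.BirchSwinnertonDyer.Theorems.SteinbergFibreAtTwo.ArchOfLemma46

end
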